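import Literature.NumberTheory.GaloisRepresentations.HomDualLocalData
import Literature.NumberTheory.GaloisRepresentations.IdeleReadoutUnramifiedValues
import HarnessLib

/-!
# Unit-valued maps read off UNRAMIFIED classes (`F2` of the presentation road; converse of `HomDualUnramifiedSplitting`):
# the local readout of an idèle-valued map is unramified at almost every place (Milne *ADT* I Lemma 4.13)

Topic `NumberTheory/GaloisRepresentations`; namespaces `Literature.NumberTheory.GaloisRepresentations.IsNonarchimedeanLocalField`
(§1), `Literature.NumberTheory.GaloisRepresentations` (§2) and `Literature.NumberTheory.GaloisRepresentations.HomDual` (§3–§4).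
Theorems only; no definition, no named fact, no instance, no `sorry`.  One LOCAL instance attribute in §4
(`absoluteGaloisGroup_compactSpace`, the tree's theorem: finiteness of `Γ_K ⧸ U_{K(M)}`).  Sequel (converse direction) of
door-c6's `HomDualUnramifiedSplitting` (`F5`: an unramified class is the readout of a unit-valued map) and of door-c5's
`IdeleReadoutUnramifiedValues` (readouts of `X ⟶ J̄` are unit-valued and `K_v^{nr}`-valued off a finite set).

THE MATHEMATICS.  `k` a nonarchimedean local field of characteristic `0`, `k^{nr} ⊆ k̄` its maximal unramified extension,
`I_k = Gal(k̄/k^{nr})` (`galUnr k = absInertia k`).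
* §1 **Roots of unramified units are unramified**: if `u ∈ k^{nr}` has `‖u‖ = 1` and `d` is a unit of `𝒪_k` (i.e. `p ∤ d`),
  every `a ∈ k̄` with `a^d = u` lies in `k^{nr}` — for `σ ∈ I_k`, `η = σa/a` is a `d`-th root of unity with `‖η − 1‖ =
  ‖σa − a‖ < 1` (Neukirch's inertia criterion `mem_absInertia_iff_algNorm`), so `η = 1` (`eq_one_of_pow_eq_one_of_algNorm_sub_one_lt_one`,
  Serre IV §4); `k^{nr}` is the fixed field of `I_k` (`mem_maxUnramified_of_forall_galUnr`).  With `k̄` algebraically closed: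
  **`exists_pow_eq_of_mem_maxUnramified`**.
* §2 `H¹` of a BIJECTIVE equivariant map is injective (`galoisCohomology.map_one_injective_of_bijective`).
* §3 **`dualδ₀ h` is unramified for a unit-, `k^{nr}`-valued `h`** (`dualδ₀_mem_unramifiedSubgroup_of_forall_mem_maxUnramified`):
  `0 → X → P → Z → 0` short exact, `P` with a permuted basis fixed by `I_k`, `Z` killed by `n`, `p ∤ n`, `h : X → k̄ˣ` equivariant
  with values units of `k^{nr}`.  Over `k' = k^{nr}` the inclusion `X ⊆ P` has a Smith normal form `(d_j e_j)_j ⊆ (e_i)_i`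
  (Mathlib `Submodule.smithNormalForm`) with `d_j ∣ n` (`n P ⊆ X`); choosing `d_j`-th roots `r_j ∈ k^{nr}` of `h(d_j e_j)` (§1)
  defines `q : P → (k^{nr})ˣ`, `e_j ↦ r_j`, extending `h`; `q` is `Γ_{k'}`-equivariant because `Γ_{k'} → I_k` acts trivially on `P`
  and on `k^{nr}`.  Hence `dualδ₀^{k'}(h) = 0` (`dualδ₀_eq_zero_iff`), i.e. `res_{k'} dualδ₀(h) = 0` (`map_res_dualδ₀_eq` with the
  identity transfer, §2), i.e. `dualδ₀ h ∈ H¹_{nr}`.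
* §4 **The canonical presentation over a number field**: `localReadout ρ n hM K_v h ∈ H¹_{nr}(K_v, ρ^∨(1))` for unit-,
  `K_v^{nr}`-valued `h` at `v ∤ n` with `ρ` unramified (`localReadout_mem_unramifiedSubgroup_of_unitValued`), and
  **`exists_finset_forall_readout_mem_unramifiedSubgroup`**: for `f : N₁ ⟶ J̄` the readouts `readout ρ n hM (π_v) f` are
  unramified at every `v` off a finite set at which `v ∤ n` and `ρ` is unramified — the input `hRur` of the (R4) reciprocity
  EQUALITY (`SchneiderFreeAdditiveX3PoitouTateReciprocityEquality.hR4_ideleProjection_of_readoutUnramified`, door-c5 g18).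
HONEST FRAMING: local algebra over the cited files; no case of Poitou–Tate or BSD is proved here.  Crux
`stmt-BirchSwinnertonDyer-19295` (cell `bsd-schneider-ideate`, seat door-c5 gen 18).

## References
* J. S. Milne, *Arithmetic Duality Theorems* (2nd ed. 2006), I Lemma 4.13 (proof), I §2 (unramified classes). [MilneADT2006]
* J.-P. Serre, *Local Fields* (1979), IV §4 (Prop. 16, Cor. 2), II §3. [SerreLocalFields1979]
* J. Neukirch, *Algebraic Number Theory* (1999), II (9.3), (7.5). [NeukirchANT1999]
-/

noncomputable section

namespace Literature.NumberTheory.GaloisRepresentations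

open Function ContRepresentation Field ValuativeRel

/-! ## §1 Roots of unramified units lie in `k^{nr}` -/

namespace IsNonarchimedeanLocalField

open IntermediateField Literature.AnabelianGeometry.AbsoluteAnabelian

variable (k : Type) [Field k] [ValuativeRel k] [TopologicalSpace k] [IsNonarchimedeanLocalField k]

/-- **Inertia fixes the `d`-th roots of a unit of `k^{nr}`, `p ∤ d`**: for `u ∈ k^{nr}` with `‖u‖ = 1`, `a^d = u` and
`σ ∈ I_k`, `σ a = a` (`η = σa/a` is a `d`-th root of unity with `‖η - 1‖ < 1`).
[cite: SerreLocalFields1979, IV §4 Prop. 16][cite: NeukirchANT1999, Ch. II (9.3), (7.5)] -/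
theorem smul_eq_self_of_mem_galUnr_of_pow_eq {d : ℕ} (hd : IsUnit ((d : ℕ) : 𝒪[k])) {u a : AlgebraicClosure k}
    (hu : u ∈ maxUnramified k) (hu1 : algNorm k u = 1) (ha : a ^ d = u)
    {σ : absoluteGaloisGroup k} (hσ : σ ∈ galUnr k) : σ • a = a := by
  have hd0 : d ≠ 0 := by
    rintro rfl
    simp at hd
  -- `‖a‖ = 1`, so `a ≠ 0`
  have ha1 : algNorm k a = 1 := by
    have h := congrArg (algNorm k) ha
    rw [algNorm_pow, hu1] at h
    exact (pow_eq_one_iff_of_nonneg (algNorm_nonneg a) hd0).1 h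
  have ha0 : a ≠ 0 := fun h => by
    rw [h, algNorm_zero] at ha1
    exact zero_ne_one ha1
  -- `σ` lies in the inertia group and fixes `u`
  rw [galUnr_eq_absInertia] at hσ
  have hσu : σ • u = u := (mem_absInertia_iff_forall_mem_maxUnramified.1 hσ) u hu
  -- the root of unity `η = σ a / a`
  set η : AlgebraicClosure k := σ • a * a⁻¹ with hη
  have hηd : η ^ d = 1 := by
    rw [hη, mul_pow, absoluteGaloisGroup.smul_def, ← map_pow, ← absoluteGaloisGroup.smul_def, ha, hσu, ← ha,
      inv_pow, mul_inv_cancel₀ (pow_ne_zero _ ha0)]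
  have hη1 : algNorm k (η - 1) < 1 := by
    have hsub : η - 1 = (σ • a - a) * a⁻¹ := by
      rw [hη, sub_mul, mul_inv_cancel₀ ha0]
    rw [hsub, algNorm_mul, algNorm_inv, ha1, inv_one, mul_one]
    exact (mem_absInertia_iff_algNorm.1 hσ) a ha1.le
  have hone : η = 1 := eq_one_of_pow_eq_one_of_algNorm_sub_one_lt_one hd hηd hη1
  -- hence `σ a = a`
  have h := congrArg (· * a) hone
  simp only [hη, inv_mul_cancel_right₀ ha0, one_mul] at h
  exact h

/-- **`d`-th roots of units of `k^{nr}` lie in `k^{nr}`** (`p ∤ d`; characteristic `0`: `k^{nr}` is the fixed field of `I_k`).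
[cite: SerreLocalFields1979, IV §4 Prop. 16, Cor. 2][cite: NeukirchANT1999, Ch. II (7.5)] -/
theorem mem_maxUnramified_of_pow_eq [CharZero k] {d : ℕ} (hd : IsUnit ((d : ℕ) : 𝒪[k])) {u a : AlgebraicClosure k}
    (hu : u ∈ maxUnramified k) (hu1 : algNorm k u = 1) (ha : a ^ d = u) : a ∈ maxUnramified k :=
  mem_maxUnramified_of_forall_galUnr k fun _ hσ => smul_eq_self_of_mem_galUnr_of_pow_eq k hd hu hu1 ha hσ

/-- **A unit of `k^{nr}` has a `d`-th root in `k^{nr}`, `p ∤ d`** (the root exists in the algebraically closed `k̄` and lies in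
`k^{nr}` by the previous theorem); the root is again a unit. [cite: SerreLocalFields1979, IV §4 Prop. 16, Cor. 2; II §3]
[cite: NeukirchANT1999, Ch. II (7.5)] -/
theorem exists_pow_eq_of_mem_maxUnramified [CharZero k] {d : ℕ} (hd : IsUnit ((d : ℕ) : 𝒪[k]))
    {u : AlgebraicClosure k} (hu : u ∈ maxUnramified k) (hu1 : algNorm k u = 1) :
    ∃ a : AlgebraicClosure k, a ∈ maxUnramified k ∧ algNorm k a = 1 ∧ a ^ d = u := by
  have hd0 : d ≠ 0 := by
    rintro rfl
    simp at hd
  obtain ⟨a, ha⟩ := IsAlgClosed.exists_pow_nat_eq u (Nat.pos_of_ne_zero hd0)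
  refine ⟨a, mem_maxUnramified_of_pow_eq k hd hu hu1 ha, ?_, ha⟩
  have h := congrArg (algNorm k) ha
  rw [algNorm_pow, hu1] at h
  exact (pow_eq_one_iff_of_nonneg (algNorm_nonneg a) hd0).1 h

end IsNonarchimedeanLocalField

/-! ## §2 `H¹` of a bijective equivariant map is injective -/

section MapInjective

variable {K : Type} [Field K]
variable {M M' : Type} [AddCommGroup M] [TopologicalSpace M] [DiscreteTopology M]
  [AddCommGroup M'] [TopologicalSpace M'] [DiscreteTopology M']
  {ρ : DiscreteGaloisModule K M} {ρ' : DiscreteGaloisModule K M'}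

/-- **`H¹(f)` is injective for a BIJECTIVE equivariant `f : M → M'`**: a crossed homomorphism `φ` with `f ∘ φ = ∂ w'`
has `φ = ∂ (f⁻¹ w')`. [cite: SerreGaloisCohomology1997, I §2.2] -/
theorem galoisCohomology.map_one_injective_of_bijective (f : ρ.toContRepresentation →ⁱL ρ'.toContRepresentation)
    (hf : Bijective f) : Injective (galoisCohomology.map f 1) := by
  refine (injective_iff_map_eq_zero _).2 fun x hx => ?_
  obtain ⟨φ, rfl⟩ := oneCocycleClass_surjective _ x
  rw [galoisCohomology.map_one_oneCocycleClass] at hx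
  obtain ⟨w', hw'⟩ := (oneCocycleClass_eq_zero_iff _ _).1 hx
  obtain ⟨w, rfl⟩ := hf.2 w'
  refine (oneCocycleClass_eq_zero_iff _ _).2 ⟨w, fun g => hf.1 ?_⟩
  have h := hw' g
  change f (φ.1 g) = ρ' g (f w) - f w at h
  change f (φ.1 g) = f (ρ g w - w)
  rw [h, map_sub]
  congr 1
  have := f.isIntertwining g w
  simpa [ContinuousRep.toContRepresentation_apply_apply] using this.symm

end MapInjective

/-! ## §3 `dualδ₀ h` is unramified for a unit-, `k^{nr}`-valued `h` on an unramified permutation presentation -/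

namespace HomDual

open Literature.Algebra.Homology Literature.Algebra.Homology.DiscreteRep HomPermutation DiscreteGaloisModule
  IsNonarchimedeanLocalField Literature.AnabelianGeometry.AbsoluteAnabelian

section Local

variable {k : Type} [Field k] [ValuativeRel k] [TopologicalSpace k] [IsNonarchimedeanLocalField k] [CharZero k]
variable {X VP Z : Type}
  [AddCommGroup X] [TopologicalSpace X] [DiscreteTopology X] [Module.Finite ℤ X]
  [AddCommGroup VP] [TopologicalSpace VP] [DiscreteTopology VP] [Module.Finite ℤ VP]
  [AddCommGroup Z] [TopologicalSpace Z] [DiscreteTopology Z] [Module.Finite ℤ Z]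
variable {ρX : DiscreteGaloisModule k X} {ρP : DiscreteGaloisModule k VP} {ρZ : DiscreteGaloisModule k Z}
  {i : ρX.toContRepresentation →ⁱL ρP.toContRepresentation}
  {p : ρP.toContRepresentation →ⁱL ρZ.toContRepresentation}
variable {β : Type} [Finite β] [MulAction (absoluteGaloisGroup k) β] (e : Module.Basis β ℤ VP)

omit [CharZero k] [Module.Finite ℤ VP] [Finite β] in
/-- An inertia-fixed permuted basis: `I_k` acts trivially on all of `P`. [cite: MilneADT2006, I Lemma 4.13 (proof)] -/
theorem apply_eq_self_of_mem_galUnr (he : PermutedBasis k ρP e)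
    (hstab : ∀ b : β, galUnr k ≤ MulAction.stabilizer (absoluteGaloisGroup k) b)
    {τ : absoluteGaloisGroup k} (hτ : τ ∈ galUnr k) (y : VP) : ρP τ y = y := by
  have hlin : (ρP τ : VP →ₗ[ℤ] VP) = LinearMap.id := e.ext fun b => by
    rw [LinearMap.id_apply, he τ b, MulAction.mem_stabilizer_iff.1 (hstab b hτ)]
  exact LinearMap.congr_fun hlin y

omit [ValuativeRel k] [TopologicalSpace k] [IsNonarchimedeanLocalField k] [CharZero k] in
/-- The identity transfer `K̄ˣ|_{Γ_{k'}} → K̄ˣ|_{Γ_{k'}}` on `H¹` is injective (post-composition with the identity is a bijection on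
`Hom_ℤ(Z, k̄ˣ)`). [cite: MilneADT2006, I §0] -/
theorem map_postcompRes_id_injective (k' : Type) [Field k'] [Algebra k k'] :
    Injective (galoisCohomology.map (postcompRes ρZ (units k) ((units k).restrictField k')
      (ContIntertwiningMap.id : ((units k).restrictField k').toContRepresentation →ⁱL
        ((units k).restrictField k').toContRepresentation)) 1) := by
  refine galoisCohomology.map_one_injective_of_bijective _ ⟨fun F G hFG => ?_, fun F => ⟨F, ?_⟩⟩
  · have h : ∀ z : Z, (show Z →ₗ[ℤ] UnitsCarrier k from F) z = (show Z →ₗ[ℤ] UnitsCarrier k from G) z := fun z => by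
      have := LinearMap.congr_fun (congrArg (fun H : DiscreteRep.HomCarrier Z (UnitsCarrier k) =>
        (show Z →ₗ[ℤ] UnitsCarrier k from H)) hFG) z
      simp only [postcompRes_apply, postcompAddHom_apply] at this
      exact this
    exact LinearMap.ext h
  · rw [postcompRes_apply]
    exact LinearMap.ext fun z => rfl

/-- **`dualδ₀ h ∈ H¹_{nr}` for an equivariant `h : X → k̄ˣ` with values units of `k^{nr}`** on a short exact `0 → X → P → Z → 0`
whose permuted basis of `P` is fixed by `I_k` and whose `Z` is killed by `n`, `p ∤ n` (Smith normal form extension of `h` to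
`P` over `k^{nr}` with `d_j`-th roots of the values, §1). [cite: MilneADT2006, I Lemma 4.13 (proof), I §2]
[cite: SerreLocalFields1979, IV §4] -/
theorem dualδ₀_mem_unramifiedSubgroup_of_forall_mem_maxUnramified
    (hS : IsSES (toTopRepHom ρX ρP i) (toTopRepHom ρP ρZ p))
    {n : ℕ} (hn : IsUnit ((n : ℕ) : 𝒪[k])) (hZ : ∀ z : Z, n • z = 0) (he : PermutedBasis k ρP e)
    (hstab : ∀ b : β, galUnr k ≤ MulAction.stabilizer (absoluteGaloisGroup k) b)
    (h : (homGaloisModule ρX (units k)).toTopRep.ρ.invariants)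
    (hnr : ∀ x : X, (unitsVal k ((show X →ₗ[ℤ] UnitsCarrier k from
        (h.1 : DiscreteRep.HomCarrier X (UnitsCarrier k))) x) : AlgebraicClosure k) ∈ maxUnramified k)
    (hunit : ∀ x : X, algNorm k (unitsVal k ((show X →ₗ[ℤ] UnitsCarrier k from
        (h.1 : DiscreteRep.HomCarrier X (UnitsCarrier k))) x) : AlgebraicClosure k) = 1) :
    dualδ₀ ρX ρP ρZ (units k) i p hS (baer_unitsCarrier k) h ∈ (homGaloisModule ρZ (units k)).unramifiedSubgroup 1 := by
  classical
  haveI : Normal k (maxUnramified k) := normal_maxUnramified k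
  set H : X →ₗ[ℤ] UnitsCarrier k :=
    (show X →ₗ[ℤ] UnitsCarrier k from (h.1 : DiscreteRep.HomCarrier X (UnitsCarrier k))) with hHdef
  -- the linear inclusion `X ↪ P` and its range `N`
  set iL : X →ₗ[ℤ] VP := (i.toContinuousLinearMap : X →L[ℤ] VP).toLinearMap with hiL
  have hiL_apply : ∀ x, iL x = i x := fun _ => rfl
  have hinj : Injective iL := fun x y hxy => hS.injective hxy
  set N : Submodule ℤ VP := LinearMap.range iL with hN
  -- `n • P ⊆ N`
  have hnP : ∀ y : VP, (n : ℤ) • y ∈ N := fun y => by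
    have h0 : p ((n : ℤ) • y) = 0 := by
      rw [map_zsmul, natCast_zsmul]
      exact hZ (p y)
    obtain ⟨x, hx⟩ := hS.exact_mid ((n : ℤ) • y) h0
    exact ⟨x, hx⟩
  -- Smith normal form of `N ⊆ P`
  obtain ⟨m, snf⟩ := Submodule.smithNormalForm e N
  -- every elementary divisor divides `n`, hence is a unit of `𝒪_k`
  have hdvd : ∀ j : Fin m, snf.a j ∣ (n : ℤ) := fun j => by
    have hrepr := snf.repr_apply_embedding_eq_repr_smul ⟨(n : ℤ) • snf.bM (snf.f j), hnP _⟩ (i := j)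
    have hl : snf.bM.repr ((⟨(n : ℤ) • snf.bM (snf.f j), hnP _⟩ : N) : VP) (snf.f j) = (n : ℤ) := by
      change snf.bM.repr ((n : ℤ) • snf.bM (snf.f j)) (snf.f j) = (n : ℤ)
      rw [map_zsmul, Finsupp.smul_apply, snf.bM.repr_self, Finsupp.single_eq_same, smul_eq_mul, mul_one]
    rw [hl, map_zsmul, Finsupp.smul_apply, smul_eq_mul] at hrepr
    exact Dvd.intro _ hrepr.symm
  have hunitA : ∀ j : Fin m, IsUnit (((snf.a j).natAbs : ℕ) : 𝒪[k]) := fun j => by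
    refine isUnit_of_dvd_unit (Nat.cast_dvd_cast ?_) hn
    have := Int.natAbs_dvd_natAbs.2 (hdvd j)
    simpa using this
  -- the preimages `xN j ∈ X` of the aligned basis of `N`
  set eX : X ≃ₗ[ℤ] N := LinearEquiv.ofInjective iL hinj with heX
  set xN : Fin m → X := fun j => eX.symm (snf.bN j) with hxN
  have hixN : ∀ j, iL (xN j) = (snf.bN j : VP) := fun j => by
    rw [← LinearEquiv.ofInjective_apply (h := hinj), hxN]
    change ((eX (eX.symm (snf.bN j)) : N) : VP) = _
    rw [LinearEquiv.apply_symm_apply]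
  -- roots `r j ∈ k^{nr}` with `(r j) ^ |a j| = h (xN j)`
  have hex : ∀ j : Fin m, ∃ a : AlgebraicClosure k, a ∈ maxUnramified k ∧ algNorm k a = 1 ∧
      a ^ (snf.a j).natAbs = (unitsVal k (H (xN j)) : AlgebraicClosure k) := fun j =>
    exists_pow_eq_of_mem_maxUnramified k (hunitA j) (hnr (xN j)) (hunit (xN j))
  choose r hr_mem hr1 hr_pow using hex
  have hr0 : ∀ j, r j ≠ 0 := fun j h0 => by
    have := hr1 j
    rw [h0, algNorm_zero] at this
    exact zero_ne_one this
  -- the values `R j` of the extension on the aligned basis of `P`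
  set R : Fin m → UnitsCarrier k := fun j => (snf.a j).sign • UnitsCarrier.ofUnits (Units.mk0 (r j) (hr0 j)) with hR
  have hRa : ∀ j, snf.a j • R j = H (xN j) := fun j => by
    apply unitsVal_injective k
    apply Units.ext
    rw [hR, smul_smul, unitsVal_zsmul, unitsVal_ofUnits, mul_comm, Int.sign_mul_self_eq_natAbs, zpow_natCast,
      Units.val_pow_eq_pow_val, Units.val_mk0, hr_pow]
  have hR_mem : ∀ j, R j ∈ unrValued k := fun j => by
    rw [hR]
    refine Submodule.smul_mem _ _ ?_
    rw [mem_unrValued_iff, unitsVal_ofUnits, Units.val_mk0]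
    exact hr_mem j
  -- the extension `Q : P → K̄ˣ`
  set Q : VP →ₗ[ℤ] UnitsCarrier k := ∑ j : Fin m, (snf.bM.coord (snf.f j)).smulRight (R j) with hQ
  have hQ_apply : ∀ y : VP, Q y = ∑ j : Fin m, snf.bM.repr y (snf.f j) • R j := fun y => by
    rw [hQ, LinearMap.sum_apply]
    rfl
  have hQbM : ∀ j : Fin m, Q (snf.bM (snf.f j)) = R j := fun j => by
    rw [hQ_apply, Finset.sum_eq_single j]
    · rw [snf.bM.repr_self, Finsupp.single_eq_same, one_smul]
    · intro j' _ hj'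
      rw [snf.bM.repr_self, Finsupp.single_apply, if_neg (fun h => hj' (snf.f.injective h).symm), zero_smul]
    · intro h
      exact absurd (Finset.mem_univ j) h
  have hQN : ∀ j : Fin m, Q (snf.bN j : VP) = H (xN j) := fun j => by
    rw [snf.snf j, map_zsmul, hQbM, hRa]
  have hQi : Q ∘ₗ iL = H := by
    refine (snf.bN.map eX.symm).ext fun j => ?_
    rw [LinearMap.comp_apply, Module.Basis.map_apply]
    change Q (iL (xN j)) = H (xN j)
    rw [hixN, hQN]
  have hQmem : ∀ y : VP, (unitsVal k (Q y) : AlgebraicClosure k) ∈ maxUnramified k := fun y => by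
    rw [← mem_unrValued_iff, hQ_apply]
    exact Submodule.sum_mem _ fun j _ => Submodule.smul_mem _ _ (hR_mem j)
  -- `Q` is `Γ_{k'}`-equivariant, `k' = k^{nr}`: inertia acts trivially on `P` and on the values
  have hQσ : ∀ (σ : absoluteGaloisGroup (maxUnramified k)) (y : VP),
      Q ((ρP.restrictField (maxUnramified k)) σ y) = ((units k).restrictField (maxUnramified k)) σ (Q y) := by
    intro σ y
    have hτ := absGaloisRestrict_mem_galUnr k σ
    rw [GaloisRep.restrictField_apply, GaloisRep.restrictField_apply, apply_eq_self_of_mem_galUnr e he hstab hτ y]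
    apply unitsVal_injective k
    apply Units.ext
    rw [unitsVal_apply, Units.coe_smul]
    rw [galUnr_eq_absInertia] at hτ
    exact ((mem_absInertia_iff_forall_mem_maxUnramified.1 hτ) _ (hQmem y)).symm
  set q' := invariantOfEquivariant (ρP.restrictField (maxUnramified k)) ((units k).restrictField (maxUnramified k)) Q hQσ
    with hq'
  -- over `k'` the transferred `h` IS the restriction of `q'`, so its `dualδ₀` vanishes
  have heq : (transferInvariant ρX (units k) ((units k).restrictField (maxUnramified k))
      (ContIntertwiningMap.id : ((units k).restrictField (maxUnramified k)).toContRepresentation →ⁱL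
        ((units k).restrictField (maxUnramified k)).toContRepresentation) h :
        DiscreteRep.HomCarrier X (UnitsCarrier k)) =
      precomp (ρX.restrictField (maxUnramified k)) (ρP.restrictField (maxUnramified k))
        ((units k).restrictField (maxUnramified k)) (restrictIntertwining ρX ρP i) q' := by
    refine LinearMap.ext fun x => ?_
    rw [coe_transferInvariant, postcompAddHom_apply, precomp_apply_apply, restrictIntertwining_apply, hq',
      coe_invariantOfEquivariant]
    change H x = Q (iL x)
    rw [← hQi, LinearMap.comp_apply]
  have hδ' : dualδ₀ (ρX.restrictField (maxUnramified k)) (ρP.restrictField (maxUnramified k))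
      (ρZ.restrictField (maxUnramified k)) ((units k).restrictField (maxUnramified k))
      (restrictIntertwining ρX ρP i) (restrictIntertwining ρP ρZ p) (isSES_restrict ρX ρP ρZ hS) (baer_unitsCarrier k)
      (transferInvariant ρX (units k) ((units k).restrictField (maxUnramified k))
        (ContIntertwiningMap.id : ((units k).restrictField (maxUnramified k)).toContRepresentation →ⁱL
          ((units k).restrictField (maxUnramified k)).toContRepresentation) h) = 0 :=
    (dualδ₀_eq_zero_iff _ _ _ _ _ _ _ _ _).2 ⟨q', heq⟩
  -- hence `res_{k'} (dualδ₀ h) = 0`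
  have hmap := map_res_dualδ₀_eq ρX ρP ρZ (units k) ((units k).restrictField (maxUnramified k))
    (ContIntertwiningMap.id : ((units k).restrictField (maxUnramified k)).toContRepresentation →ⁱL
      ((units k).restrictField (maxUnramified k)).toContRepresentation) i p hS (baer_unitsCarrier k) (baer_unitsCarrier k) h
  rw [hδ'] at hmap
  have hres : galoisCohomology.res (homGaloisModule ρZ (units k)) (maxUnramified k) 1
      (dualδ₀ ρX ρP ρZ (units k) i p hS (baer_unitsCarrier k) h) = 0 :=
    map_postcompRes_id_injective (ρZ := ρZ) (maxUnramified k) (by rw [hmap, map_zero])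
  exact (DiscreteGaloisModule.mem_unramifiedSubgroup_iff _ _ _).2 hres

end Local

/-! ## §4 The canonical presentation over a number field: readouts are unramified almost everywhere -/

section NumberField

open FreePresentation DGMBridge IdeleReadout NumberField IsDedekindDomain

-- finiteness of `Γ_K ⧸ U_{K(M)}` (the index set of the permuted basis) needs `Γ_K` compact: the tree's theorem, local.
attribute [local instance] absoluteGaloisGroup_compactSpace

variable {K : Type} [Field K] [NumberField K]
variable {M : Type} [AddCommGroup M] [TopologicalSpace M] [DiscreteTopology M] [Finite M]
variable (ρ : DiscreteGaloisModule K M) (n : ℕ) [NeZero n]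

/-- **`localReadout h ∈ H¹_{nr}(K_v, ρ^∨(1))` for a unit-, `K_v^{nr}`-valued equivariant `h : N₁ → K̄_vˣ`** at a finite place
`v ∤ n` where `ρ` is unramified (§3 for the restricted canonical presentation `0 → N₁ → P → M → 0`: its permuted basis
`Fin |M| × Γ_K ⧸ U_{K(M)}` is fixed by the inertia group because `ker ρ` is, `galUnr_le_stabilizer_of_isUnramifiedAt`; transport
along `e⁻¹ : Hom(M, K̄_vˣ) ≅ ρ^∨(1)`).  Converse of door-c6's `exists_unitValued_localReadout_eq`.
[cite: MilneADT2006, I Lemma 4.13 (proof), I §2][cite: SerreLocalFields1979, IV §4] -/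
theorem localReadout_mem_unramifiedSubgroup_of_unitValued (hM : ∀ m : M, n • m = 0) (v : HeightOneSpectrum (𝓞 K))
    [CharZero (v.adicCompletion K)]
    (hn : IsUnit ((n : ℕ) : 𝒪[v.adicCompletion K])) (hur : GaloisRep.IsUnramifiedAt v ρ)
    (h : (haveI := moduleFinite_presModule₁ ρ
      (homGaloisModule ((presModule₁ ρ).restrictField (v.adicCompletion K)) (units (v.adicCompletion K))).toTopRep.ρ.invariants))
    (hnr : ∀ x : LCarrier (presentationComplex ρ).X₁,
      ((unitsVal (v.adicCompletion K) ((show LCarrier (presentationComplex ρ).X₁ →ₗ[ℤ] UnitsCarrier (v.adicCompletion K) from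
        (h.1 : DiscreteRep.HomCarrier (LCarrier (presentationComplex ρ).X₁) (UnitsCarrier (v.adicCompletion K)))) x) :
        (AlgebraicClosure (v.adicCompletion K))ˣ) : AlgebraicClosure (v.adicCompletion K)) ∈ maxUnramified (v.adicCompletion K))
    (hunit : ∀ x : LCarrier (presentationComplex ρ).X₁,
      algNorm (v.adicCompletion K) ((unitsVal (v.adicCompletion K)
        ((show LCarrier (presentationComplex ρ).X₁ →ₗ[ℤ] UnitsCarrier (v.adicCompletion K) from
          (h.1 : DiscreteRep.HomCarrier (LCarrier (presentationComplex ρ).X₁) (UnitsCarrier (v.adicCompletion K)))) x) :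
        (AlgebraicClosure (v.adicCompletion K))ˣ) : AlgebraicClosure (v.adicCompletion K)) = 1) :
    localReadout ρ n hM (v.adicCompletion K) h ∈ unramifiedSubgroup ((ρ.tateDual n).restrictField (v.adicCompletion K)) 1 := by
  haveI := moduleFinite_presModule₁ ρ
  haveI := moduleFinite_presModule₂ ρ
  haveI : Finite (absoluteGaloisGroup K ⧸ ((presentationLayer ρ).openNormalSubgroup : Subgroup (absoluteGaloisGroup K))) :=
    Subgroup.quotient_finite_of_isOpen _ (LayerColimit.coe_isOpen (presentationLayer ρ).openNormalSubgroup)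
  letI := resAction K (v.adicCompletion K) (PresIndex ρ)
  have hδ := dualδ₀_mem_unramifiedSubgroup_of_forall_mem_maxUnramified (presModuleBasis ρ)
    (isSES_restrict (presModule₁ ρ) (presModule₂ ρ) ρ (pres_isSES ρ)) hn hM
    (permutedBasis_restrict (permutedBasis_presModule₂ ρ))
    (fun b => galUnr_le_stabilizer_of_isUnramifiedAt v ρ hur (fun γ b hγ => smul_presIndex_eq_of_apply_eq_one ρ γ b hγ) b)
    h hnr hunit
  have hδ' : galoisCohomology.res (homGaloisModule (ρ.restrict (absGaloisRestrict K (v.adicCompletion K)))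
      (units (v.adicCompletion K))) (maxUnramified (v.adicCompletion K)) 1
      (dualδ₀ ((presModule₁ ρ).restrictField (v.adicCompletion K)) ((presModule₂ ρ).restrictField (v.adicCompletion K))
        (ρ.restrictField (v.adicCompletion K)) (units (v.adicCompletion K))
        (restrictIntertwining (presModule₁ ρ) (presModule₂ ρ) (presIncl ρ))
        (restrictIntertwining (presModule₂ ρ) ρ (presProj ρ))
        (isSES_restrict (presModule₁ ρ) (presModule₂ ρ) ρ (pres_isSES ρ)) (baer_unitsCarrier (v.adicCompletion K)) h) = 0 :=
    (DiscreteGaloisModule.mem_unramifiedSubgroup_iff _ _ _).1 hδ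
  change galoisCohomology.map (tateDualRestrictUnitsIso K (v.adicCompletion K) ρ n hM).inv.hom 1 _ ∈ _
  refine (DiscreteGaloisModule.mem_unramifiedSubgroup_iff _ _ _).2 ?_
  refine (galoisCohomology.res_map_one (maxUnramified (v.adicCompletion K)) _ _).trans ?_
  rw [hδ', map_zero]

/-- **The readouts of an idèle-valued map are unramified almost everywhere** (`F2` / input `hRur` of the (R4) reciprocity
equality): for `f : N₁ ⟶ J̄` there is a finite set `T` of finite places such that at every `v ∉ T` with `v ∤ n` and `ρ`
unramified, `readout ρ n hM π_v f ∈ H¹_{nr}(K_v, ρ^∨(1))` (`T` = where a readout value fails to be a unit,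
`exists_finset_forall_ordQ_readoutMap_eq_zero`, or `N₁` fails to be unramified, `exists_finset_forall_isUnramifiedAt_toDGM`).
[cite: MilneADT2006, I Lemma 4.13 (proof), I §4][cite: CasselsFrohlichANT1967, Ch. VII §7.3] -/
theorem exists_finset_forall_readout_mem_unramifiedSubgroup (hM : ∀ m : M, n • m = 0)
    (f : (presentationComplex ρ).X₁ ⟶ ideleBarD K) :
    ∃ T : Finset (HeightOneSpectrum (𝓞 K)), ∀ v ∉ T, IsUnit ((n : ℕ) : 𝒪[v.adicCompletion K]) →
      GaloisRep.IsUnramifiedAt v ρ →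
        readout ρ n hM (ideleProjection K (Sum.inr v)) f ∈ unramifiedSubgroup (GaloisRep.toLocal v (ρ.tateDual n)) 1 := by
  classical
  haveI := moduleFinite_presModule₁ ρ
  obtain ⟨T₀, hT₀⟩ := exists_finset_forall_ordQ_readoutMap_eq_zero (presentationLayer ρ) (X := (presentationComplex ρ).X₁)
    (presentationComplex_X₁_trivial ρ) f
  obtain ⟨T₁, hT₁⟩ := exists_finset_forall_isUnramifiedAt_toDGM (presentationLayer ρ) (presentationComplex ρ).X₁
    (presentationComplex_X₁_trivial ρ)
  refine ⟨T₀ ∪ T₁, fun v hv hn hur => ?_⟩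
  have hv₀ : v ∉ T₀ := fun h' => hv (Finset.mem_union_left _ h')
  have hv₁ : v ∉ T₁ := fun h' => hv (Finset.mem_union_right _ h')
  haveI : CharZero (v.adicCompletion K) := charZero_of_algebra (K := K) (v.adicCompletion K)
  exact localReadout_mem_unramifiedSubgroup_of_unitValued ρ n hM v hn hur
    (readoutInvariant (ideleProjection K (Sum.inr v)) (presentationComplex ρ).X₁ f)
    (fun x => unitsVal_mem_maxUnramified_of_isUnramifiedAt v (hT₁ v hv₁) _ x)
    (fun x => (ordQ_eq_zero_iff _ _).1 (hT₀ v hv₀ x))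

end NumberField

end HomDual

end Literature.NumberTheory.GaloisRepresentations

end
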